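import Mathlib
import HarnessLib
import HarnessLib.Audit
import Summits.QuantumFields.Statement
import Literature.MathematicalPhysics.QuantumFieldTheory.QCDTimeReflection
import HarnessLib.Audit.Status.Attr

/-!
Route: FradkinShenkerFlow

DORMANT since 2026-08-24T23:38:45Z (reconciler: no traction for 7.2 d (last activity item-evidence-added at 2026-08-17T18:54:50Z); parked, not closed — `ledger route dormant route-QuantumFields-FradkinShenkerFlow --off` to reactivate) — unstaffed, not closed; items shared with open routes are served there. `ledger route dormant <id> --off` reactivates.

# Route FradkinShenkerFlow — Susceptibility-to-gap along the Fradkin-Shenker pinning flow: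
localisation in link coordinates turns finite gauge-invariant susceptibility into a uniform
heat-bath Poincare inequality

It suffices to show X = GAUGE SHARPNESS (card ricci-heat-kernel-polchinski-lsi-gap, down-scoped to
what its mechanism can deliver):
for every compact simple G, every faithful unitary lattice representation r and every β ≥ 0, on the
tori (ℤ/(2S+1))⁴ with Wilson's action,
(FS ⇒ UP): if the connected correlations of every pair of bounded gauge-invariant local observables
are absolutely summable over translates,
uniformly in S (finite gauge-invariant susceptibility), then the Wilson measures satisfy a
single-link HEAT-BATH (Glauber) Poincaré inequality
Var(F) ≤ C(β) Σ_ℓ E E_ℓ[(F − F^(ℓ←g))²] uniformly in S; and (UP ⇒ EC): such a uniform Poincaré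
inequality gives exponential clustering in
Euclidean time, |⟨A·τ_n B⟩ − ⟨A⟩⟨B⟩| ≤ C(A,B,β) e^(−m(β) n) for n ≤ S, uniformly in S. X is the two
implications; the inputs the line cannot
supply — finite susceptibility at weak coupling, and the continuum/OS legs — are filed as imported
cruxes 3 and 4 so that the assembly reaches YangMills.
Lean: `(∀ (G : Type) [Group G] [TopologicalSpace G] [IsTopologicalGroup G] [CompactSpace G]
[MeasurableSpace G] [BorelSpace G],
Literature.MathematicalPhysics.QuantumFieldTheory.IsCompactSimpleLieGroup G → ∀ (r :
Literature.MathematicalPhysics.QuantumFieldTheory.LatticeRep G) (β : ℝ), 0 ≤ β → (∀ A B :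
Literature.MathematicalPhysics.QuantumFieldTheory.YMSpecies G, ∃ χ : ℝ, ∀ S : ℕ, ∑ x ∈
Literature.Probability.LatticeModels.box 4 S, |ProbabilityTheory.covariance (fun U => A.F
(Literature.MathematicalPhysics.QuantumLattice.torusLift (2 * S + 1) U)) (fun U => B.F
(Literature.MathematicalPhysics.QuantumLattice.configShift (-x)
(Literature.MathematicalPhysics.QuantumLattice.torusLift (2 * S + 1) U)))
(Literature.MathematicalPhysics.QuantumFieldTheory.wilsonMeasure (d := 4) (L := 2 * S + 1) r.ρ β)| ≤
χ) → (∃ C : ℝ, ∀ S : ℕ, ∀ F : Literature.MathematicalPhysics.QuantumFieldTheory.GaugeConfig 4 (2 * S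
+ 1) G → ℝ, Measurable F → (∃ M : ℝ, ∀ U, |F U| ≤ M) → ProbabilityTheory.variance F
(Literature.MathematicalPhysics.QuantumFieldTheory.wilsonMeasure (d := 4) (L := 2 * S + 1) r.ρ β) ≤
C * ∑ ℓ : Literature.MathematicalPhysics.QuantumFieldTheory.Edge 4 (2 * S + 1), ∫ U, ∫ g, (F U - F
(Function.update U ℓ g)) ^ 2 ∂((Literature.MathematicalPhysics.QuantumFieldTheory.haarProbability
G).tilted (fun g' => -β * Literature.MathematicalPhysics.QuantumFieldTheory.wilsonAction r.ρ
(Function.update U ℓ g'))) ∂(Literature.MathematicalPhysics.QuantumFieldTheory.wilsonMeasure (d :=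
4) (L := 2 * S + 1) r.ρ β))) ∧ (∀ (G : Type) [Group G] [TopologicalSpace G] [IsTopologicalGroup G]
[CompactSpace G] [MeasurableSpace G] [BorelSpace G], ∀ (r :
Literature.MathematicalPhysics.QuantumFieldTheory.LatticeRep G) (β : ℝ), 0 ≤ β → (∃ C : ℝ, ∀ S : ℕ,
∀ F : Literature.MathematicalPhysics.QuantumFieldTheory.GaugeConfig 4 (2 * S + 1) G → ℝ, Measurable
F → (∃ M : ℝ, ∀ U, |F U| ≤ M) → ProbabilityTheory.variance F
(Literature.MathematicalPhysics.QuantumFieldTheory.wilsonMeasure (d := 4) (L := 2 * S + 1) r.ρ β) ≤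
C * ∑ ℓ : Literature.MathematicalPhysics.QuantumFieldTheory.Edge 4 (2 * S + 1), ∫ U, ∫ g, (F U - F
(Function.update U ℓ g)) ^ 2 ∂((Literature.MathematicalPhysics.QuantumFieldTheory.haarProbability
G).tilted (fun g' => -β * Literature.MathematicalPhysics.QuantumFieldTheory.wilsonAction r.ρ
(Function.update U ℓ g'))) ∂(Literature.MathematicalPhysics.QuantumFieldTheory.wilsonMeasure (d :=
4) (L := 2 * S + 1) r.ρ β)) → (∃ m : ℝ, 0 < m ∧ ∀ A B :
Literature.MathematicalPhysics.QuantumFieldTheory.YMSpecies G, ∃ C : ℝ, ∀ S n : ℕ, n ≤ S →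
|Literature.MathematicalPhysics.QuantumFieldTheory.latticeConnectedCorr r.ρ β (2 * S + 1) A.F B.F n|
≤ C * Real.exp (-(m * n))))`

## Assembly
Pure logic (checked sorry-free in Sketch.lean, `assembly_shape`): fix G simple and r;
FiniteSusceptibilityWeakCoupling gives β₀; for β ≥ max(β₀, 0), SusceptibilityToPoincare turns FS(β)
into UP(β) and PoincareToClustering turns UP(β) into EC(β); this is exactly the hypothesis of
ClusteringToYangMills, which returns YangMills. Inside the complement the standard reductions are:
EC ⇒ positivity of the infinite-volume transfer-matrix gap (reflection positivity of Wilson's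
action, OsterwalderSeilerAnnPhys1978; Glimm–Jaffe §6.1, tree timeClustering_iff_massGap) ⇒
clustering at the TRUE gap rate with self-normalised constants ⇒ the torus clause; the continuum
legs are untouched by this route.

Rationale: WHY THIS LINE. The card runs the multiscale Bakry–Émery criterion
(BauerschmidtBodineauDagallierPolchinski2024 Thm 4, Ex. 5) along the product heat-kernel flow on
G^E. Writing P_t f(U) = ∫ p_t(W) f(WU) dW (centrality), left-invariant derivatives commute with P_t
and one gets the exact identity Hess V_t(U)(h,h) = E_t^U[Hess H] − Var_t^U⟨∇H,h⟩ = −β Cov over μ_t^U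
of (⟨∇S_W,h⟩, ⟨∇log ρ_t^U,h⟩), where μ_t^U ∝ Π_ℓ p_t(U_ℓ⁻¹W_ℓ) e^(−βS_W(W)) dW is Wilson theory with
a frozen completely-breaking link "Higgs" pinned to the background U — the Fradkin–Shenker family
(FradkinShenker1979, OsterwalderSeilerAnnPhys1978): semiconvexity of the renormalised potential IS a
volume-uniform covariance bound for gauge-variant link observables of the PINNED measures. Because
the flow is ultralocal in space, its weak-pinning end is governed (frame/orbit decomposition: the
gauge frame is a high-temperature G-spin system with coupling ε_t = e^(−λ₁t), Elitzur1975 as a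
resource) by σ_t ≲ β ε_t² (C + ε_t² χ_inv(β,S)), so the criterion is finite uniformly in the volume
exactly when the gauge-INVARIANT susceptibility is bounded — the gauge analogue of "criterion finite
⟺ χ bounded" (BBD §6.3) and of BauerschmidtDagallier2023 (LSI constant = poly(χ) for near-critical
Ising): the card's claim that compactness + Elitzur close the infrared end for free is wrong (log
E_μ Π(1+ε_ℓ) has joint cumulants of DISJOINT loops), and its "gap at every β" is false at bulk
first-order points; what survives is a SHARPNESS UPGRADER, which is what we file. Stochastic
localisation in the ambient link-matrix coordinates x_ℓ = r.ρ(W_ℓ) (Eldan; Chen–Eldan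
arXiv:2203.04163 §3.1 "approximate conservation of variance"; arXiv:2007.08200) realises the same
family with the von Mises–Fisher kernel e^(s Re tr ρ(X_ℓ⁻¹W_ℓ)), needs no Riemannian structure (|x|²
is constant on unitaries, so Eldan's tilts are linear: Wilson + external link field), is EXACTLY the
Bayes-posterior path of the Gaussian channel θ_s = s·x(X) + B_s with X ~ μ_β (arXiv:2203.05093,
arXiv:2305.10690: the relevant backgrounds are PLANTED, not adversarial), starts at s = 0 where
gauge invariance bounds the covariance operator by N (ElitzurLinkCovariance) and ends at s ≥ c(1+β)
in the Dobrushin regime where Wu2006 gives the heat-bath Poincaré inequality with no curvature input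
(StrongPinningPoincare; tree LatticeGaugeDobrushinPoincare); Ricci curvature of G, the card's
headline, drops out — the group and the dimension enter only through the window covariance bounds
(U(1)₄ Coulomb phase: χ_inv = ∞, Guth1980). Imported areas: Markov-semigroup functional inequalities
(localisation schemes, Dobrushin–Wu), Bayesian planted-model structure (Nishimori/I-MMSE
integrability as the intended tool for the window), sharpness philosophy of percolation/Ising
(Simon1980, AizenmanBarskyFernandez1987, DuminilCopinTassionCMP2016 — no correlation-inequality
route exists for non-abelian gauge theories, DingSongSun2022 has no gauge analogue). Versus the tree
and neighbours: pointwise Bakry–Émery (ShenZhuZhu2022 = fact shen_zhu_zhu, |β| < 1/(16(d−1))) and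
OS78 live at strong coupling; no route exists on this sub-problem; the negatives index is empty;
this route states, in existing Lean vocabulary, what the functional-inequality programme must prove
at weak coupling and separates it cleanly from the continuum legs.

RANKED CRUXES. #0 GaugeSharpness (target) — X of the Thesis: (FS ⇒ UP) for every compact simple G,
faithful unitary r, β ≥ 0, and (UP ⇒ EC) for every compact G with a lattice representation r and β ≥
0 — finite gauge-invariant susceptibility upgrades to a uniform heat-bath Poincaré inequality, which
gives volume-uniform exponential clustering in Euclidean time. (why it might fail: FS => UP may fail
through slow gauge-orbit/toron modes of the single-link heat bath at fixed beta uniformly in S, and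
UP => EC needs beta-uniform finite speed of the heat bath; see ranks 2 and 9.)
[BauerschmidtBodineauDagallierPolchinski2024, BauerschmidtDagallier2023, arXiv:2203.04163, Wu2006,
ShenZhuZhu2022]
#2 SusceptibilityToPoincare (crux) — (card N3+N1 in measure form) for compact simple G, faithful
unitary r, β ≥ 0: if for all bounded gauge-invariant local observables A, B the susceptibility Σ_(x
∈ box 4 S) |Cov_(β,S)(A∘lift, B∘τ_x∘lift)| is bounded uniformly in S, then there is C with
Var_(μ_β,S)(F) ≤ C Σ_ℓ ∫∫ (F(U) − F(U[ℓ ↦ g]))² dν_ℓ^U(g) dμ_(β,S)(U) for all S and all bounded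
measurable F, ν_ℓ^U = the one-link conditional (heat-bath) law ∝ e^(−β S_W(U[ℓ↦g])) dHaar(g).
Intended proof: stochastic localisation in link coordinates from s = 0 (ElitzurLinkCovariance)
through the planted Fradkin–Shenker window to the Dobrushin regime (StrongPinningPoincare); any
other proof (multiscale Bakry–Émery along the heat kernel, BBD Thm 4 with Ric_G; weak-mixing ⇒ gap à
la Martinelli–Olivieri on tori) closes it equally. [deps: ElitzurLinkCovariance,
StrongPinningPoincare] [difficulty: XL] (why it might fail: The localisation window must cross the
Higgs transition s_c(beta)=O(1) of the pinned gauge-Higgs family: sup over backgrounds is false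
there (arXiv:0911.1721), typical-path (planted) control is unproved, a continuous crossing may cost
log S; no gauge Ding-Song-Sun inequality exists.) [BauerschmidtBodineauDagallierPolchinski2024,
BauerschmidtDagallier2023, arXiv:2203.04163, arXiv:2203.05093, arXiv:2007.08200, DingSongSun2022,
FradkinShenker1979, arXiv:0911.1721, MartinelliOlivieri1994]
#3 FiniteSusceptibilityWeakCoupling (crux) — IMPORTED INPUT: for compact simple G and faithful
unitary r there is β₀(G,r) such that for every β ≥ β₀ and all bounded gauge-invariant local A, B,
sup_S Σ_(x ∈ box 4 S) |Cov_(β,S)(A∘lift, B∘τ_x∘lift)| < ∞ — the absolutely-summable shadow of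
Chatterjee's Problem 5.1 / Jaffe–Witten §5 at weak coupling (β₀ beyond bulk transitions and
endpoints of reducible r). This route does not attack it; written so that routes proving clustering
or susceptibility bounds from RG / flux / continuity arguments attach here. [difficulty:
open-problem] (why it might fail: It is the infrared half of the lattice mass-gap problem
(confinement at weak coupling); false at bulk first-order points, hence only beta >= beta_0(G,r); a
weak-coupling massless phase for some simple G in d=4 would refute it and the summit's lattice leg.)
[Chatterjee1803, JaffeWitten2000, Seiler1982, Balaban1989LargeFieldII, Simon1980]
#4 ClusteringToYangMills (crux) — IMPORTED COMPLEMENT (lowest rank): if for every compact simple G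
and faithful unitary r the torus Wilson measures cluster exponentially in Euclidean time, uniformly
in the volume, at every β ≥ β₀(G,r) (rate m(β) > 0, constants C(A,B,β)), then YangMills: by
RP/transfer-matrix spectral theory EC makes the infinite-volume gap m_true(β) positive and
self-normalises the constants (torus clause, cf. card torus-clause-is-thermal-v2); choose β_k → ∞ —
since the Statement re-type of 2026-08-16 (p116790) this is also DEMANDED by the first conjunct
`sch.HasWeakCouplingLimit` (= Tendsto sch.β atTop atTop) of `YangMills`, and it is supplied INSIDE
this item, whose conclusion is `YangMills` by name (the route has no scheme among its own
hypotheses) — and a_k m_true(β_k) → Δ_phys (needs ξ(β) → ∞); build the OS continuum limit for all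
species (E0, E0', E1–E4), non-triviality and non-Gaussianity of tr F², HasMassGap and
HasLatticeMassGap. The conjunct minus the lattice-gap-positivity leg, so that UV/continuum routes
attach here. [difficulty: open-problem] (why it might fail: Contains the continuum limit with OS
axioms (E0', E1) and non-triviality (Balaban UV stability without uniqueness), xi(beta) -> infinity,
and the true mass along beta_k; every part is open and outside this line.) [JaffeWitten2000,
OsterwalderSeilerAnnPhys1978, Balaban1989LargeFieldII, Chatterjee1803, Seiler1982, GlimmJaffe1987]
#9 PoincareToClustering (support) — (card N4, heat-bath form) for compact G with lattice
representation r and β ≥ 0: the uniform heat-bath Poincaré inequality UP(β) implies ∃ m(β) > 0 ∀ A,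
B ∃ C ∀ S, n ≤ S: |⟨A·τ_(n e₀)B⟩_(β,S) − ⟨A⟩⟨B⟩| ≤ C e^(−m n). Proof route: spectral gap λ ≥
1/(2C_UP) of the continuous-time single-link heat-bath generator L = Σ_ℓ (E_ℓ − 1), Cov(F,G) = 2∫₀^∞
E Γ(P_sF, P_sG) ds, β-independent finite speed of propagation of the heat bath (influence graph =
links sharing a plaquette), split at s* ∝ dist; observables whose support exceeds small tori are
absorbed in C. [difficulty: L] [Martinelli1999, Liggett2005, ShenZhuZhu2022, Wu2006]
#9 ElitzurLinkCovariance (support) — the s = 0 end of the window, provable now: for every compact G,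
lattice representation r, β, and torus side 2S+1 ≥ 3, gauge invariance of μ_(β,S) (proved:
wilsonMeasure_map_gaugeTransform_holds) makes the matrix coordinates of distinct links uncorrelated
(average the gauge rotation at an endpoint of ℓ that is not an endpoint of ℓ' : ∫ρ(g) dg is the
projection onto ρ-invariants, which commutes with ρ), so Var(Σ_ℓ Re tr(h_ℓ ρ(U_ℓ))) = Σ_ℓ Var(Re
tr(h_ℓ ρ(U_ℓ))) ≤ N Σ_ℓ ‖h_ℓ‖_F² (Cauchy–Schwarz, ‖ρ(U)‖_F² = N): the covariance operator of the
link coordinates is bounded by N uniformly in S and β. [difficulty: provable-now] [Elitzur1975,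
Wilson1974, Seiler1982]
#9 StrongPinningPoincare (support) — the late end of the window (Dobrushin regime): there are c, C
(depending on G, r) such that for every β ≥ 0, every pinning strength s ≥ c(1+β), every torus and
EVERY background X, the pinned Wilson measure μ^(s,X) ∝ exp(s Σ_ℓ Re tr ρ(X_ℓ⁻¹ W_ℓ)) μ_(β,S)
satisfies the heat-bath Poincaré inequality with constant C w.r.t. its own one-link conditional laws
∝ e^(−βS_W(U[ℓ↦g]) + s Re tr ρ(X_ℓ⁻¹g)) dHaar(g): one-link laws concentrate at scale s^(−1/2) around
the unique non-degenerate maximum (r faithful), staples move them by O(β/s) in W₁ (perturbation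
lemma of LatticeGaugeDobrushinPoincare), so Dobrushin's coefficient is ≤ Cβ/s < 1, and Wu2006 turns
Dobrushin uniqueness into the Poincaré inequality for the heat bath. [difficulty: M] [Wu2006,
Dobrushin1968, ShenZhuZhu2022, arXiv:2204.12737]

TWO-LAYER PLAN. Foreseen glued split of crux 2 once its form is settled: SusceptibilityToPoincare ⇐
WindowCovariance → LocalisationUpgrader → SusceptibilityToPoincare, where WindowCovariance = for the
planted tilts θ_s = s·x(X) + √s·Z (X ~ μ_(β,S), Z standard Gaussian on M_N(ℂ)^E; fixed-s marginals
suffice by convexity of exp in the time average) exponential moments of the covariance operator norm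
K(θ_s) of the link coordinates under μ^(θ_s) are bounded by a(s; β, χ) with ∫₀^(c(1+β)) a ds < ∞
uniformly in S (it contains χ_inv at small s and the Higgs-transition crossing at s = O(1));
LocalisationUpgrader = the abstract theorem on finite products of a compact group: annealed window
bounds + StrongPinningPoincare + ElitzurLinkCovariance ⇒ heat-bath Poincaré with constant C·exp(∫a +
c'(1+β)) (approximate conservation of variance, Chen–Eldan §3.1, made annealed; Holley–Stroock
factor e^(4s) to compare one-link conditional variances of μ^(θ) and μ). PoincareToClustering ⇐
HeatBathFiniteSpeed → GapToDecay → PoincareToClustering (k = 2). Nothing here is filed now.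

KILL CRITERIA. (i) A computation or theorem showing that the single-link heat-bath relaxation time
(integrated autocorrelation of the plaquette / small loops) of SU(2)₄ Wilson theory at fixed
confined β (2.3–2.5, where FS is numerically evident) grows with the torus side refutes UP with FS
intact, i.e. ¬SusceptibilityToPoincare: close `refuted:SusceptibilityToPoincare`. (ii) A proof that
the typical-path (planted) window covariance diverges polynomially in S at the Higgs crossing for
all large β kills the MECHANISM but not crux 2 as stated: pivot to the weak-mixing ⇒ gap line
(Martinelli–Olivieri on tori) or close `exhausted` with the census. (iii)
FiniteSusceptibilityWeakCoupling refuted for some simple G (weak-coupling massless phase in d = 4)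
refutes the summit's lattice leg outright. (iv) Volume-uniform exponential clustering at weak
coupling proved elsewhere (RG/Bałaban-type or continuity routes) moots cruxes 2–3; the route then
contributes only PoincareToClustering-type glue and should be closed `superseded`.

NOT DECOMPOSED YET. The WindowCovariance / LocalisationUpgrader split of crux 2 (the exact annealed
hypothesis an upgrader can consume is the research question; filing a guessed form now would be
churn); the one-link concentration lemma for strongly tilted Haar measures inside
StrongPinningPoincare; log-Sobolev (vs Poincaré) and hypercontractivity — not needed for clustering;
any quantitative m(β) (the line certifies positivity only; the true rate is recovered by spectral
theory in the complement); strong coupling β < β_OS (known: OS78, shen_zhu_zhu) is not restated; the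
Riemannian heat-kernel twin (BBD Thm 4 with Ric_G = κ_G g, IsGroupHeatKernel) is kept as an
alternative proof path of crux 2, not as items, so no heat-kernel existence fact enters the cone.

CHEAPEST FALSIFIER. kit (not available to this plancard seat; first job for a refuter): heat-bath
Monte Carlo for SU(2), Wilson action, β ∈ {2.3, 2.5}, symmetric tori 4⁴, 6⁴, 8⁴, 10⁴: integrated
autocorrelation time (in sweeps) of the plaquette, the 2×2 loop and the Polyakov-loop modulus;
control run U(1) at β = 1.1 (Coulomb phase, where growth with the side IS expected and FS fails).
Growth of τ_int with the side at fixed confined β refutes UP numerically and with it crux 2; flat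
τ_int supports it. Lookup already done (this seat): Chen–Eldan arXiv:2203.04163 / EKZ
arXiv:2007.08200 give covariance ⇒ gap theorems only under DETERMINISTIC all-tilt bounds, which are
false here (Higgs transition under uniform pinning, arXiv:0911.1721) — confirms the upgrader of crux
2 is not in print and that its annealed form is the real bet.

NUMBERS. Pointwise Bakry–Émery regime of the tree fact shen_zhu_zhu: |β| < 1/(16(d−1)) = 1/48 in d =
4 ('t Hooft normalised; ShenZhuZhu2022 Assumption 1.1); OS strong coupling β < β₀(G)
(OsterwalderSeilerAnnPhys1978 Thm 3.5); SU(2) crossover β ≈ 2.2–2.5; SU(N ≥ 4–5) Wilson axis has a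
bulk first-order transition (so FS only for β ≥ β₀(G,r)); SU(2) + frozen fundamental Higgs in d = 4:
first-order line with an endpoint (arXiv:0911.1721) — the window crossing; zero-pinning covariance
operator ≤ N (ElitzurLinkCovariance); Dobrushin threshold s ≥ c(1+β) with c of order (links per
plaquette-neighbourhood = 18) × ‖staple‖ ≤ 6. Items at open: 8 (1 target, 3 cruxes, 3 support, 1
assembly). Cone (route-repair gen 2, 2026-08-15): the constant-level dependency cone of the eight
items + `closes` is 81 project constants with 0 unproved named facts (gate `h21_route_deps`
preview); the module-level blockers in the import chain of
Summits/QuantumFields/YangMills/Statement.lean itself — ClayYangMillsEuclidean,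
ClayYangMillsEuclideanGap, ClayYangMillsEuclideanAlong and CaoParkSheffieldProblem ([status: open]
conjectures), isSpecification_ymSpecification (mis-stated; corrected twin
isSpecification_ymSpecification_t2 is proved) and not_isSimpleCompactGroup_unitaryGroup (routine,
still undischarged) — are dependencies of no item, are used by no thesis as a hypothesis, and are
deliberately NOT named by any item (naming one would pull it into the cone, cf.
ParabolicTrajectory); needs-fact: none. Statement re-type (route-repair 2026-08-16, p116790,
YangMills 492ad041a631 → dc802f568854: conjunct `sch.HasWeakCouplingLimit` added): `closes` is
textually unchanged (its conclusion and crux 4's are `YangMills` by name) and was re-certified on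
the farm; the weak-coupling conjunct is crux 4's to deliver; the hubs the registered crux-4 lines
dock on (EquipartitionCriticality.CriticalContinuumLimit stmt-8762,
ConvexGribovBody.ContinuumLegGivenGap stmt-8782) are explicit pre-re-type literals and must be
repaired by their routes before those lines re-dock.

DEFINITION REQUESTS. None needed to state the items: everything is over wilsonMeasure, wilsonAction,
haarProbability, Edge/GaugeConfig (ConstructiveQFTWave0), YMSpecies, latticeConnectedCorr,
LatticeRep, IsCompactSimpleLieGroup (YangMillsOS), torusLift, configShift (LatticeGaugeDLR), box
(ThermodynamicLimit), Measure.tilted and ProbabilityTheory.variance/covariance (Mathlib). If a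
second route reuses them, the notions `HeatBathPoincare r β C` (uniform single-link heat-bath
Poincaré inequality of the torus Wilson measures) and `GaugeSusceptibilityBound r β` belong in
Literature/MathematicalPhysics/QuantumFieldTheory and would shorten every item here to one line.

Novelty: Searches (2026-08-15, this seat): `lit galaxy search "stochastic localization" --star all` (20 rows:
KLS/LSI notes, Lee–Vempala arXiv:1712.01791, no gauge theory); `lit galaxy search --star pdf --mode
bm25 "Poincare inequality or spectral gap for Langevin or Glauber dynamics of lattice Yang-Mills
gauge theory, log-Sobolev, stochastic localization, Bakry-Emery"` (15 rows: Chen–Eldan ChEl22 =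
arXiv:2203.04163 read pp. 1–6, Eldan research statement, OWR 2023/59 doi:10.4171/owr/2023/59, Liu
spectral-independence notes, Martinelli–Sinclair–Weitz; nothing on gauge theories); `lit frontier
QuantumFields --since 2023` (30 rows: SZZ/Chevyrev–Shen lineage, Faizal–Shabir arXiv:2606.19362, no
localisation/sharpness for LGT); `lit bridges QuantumFields --cross any` (sharpness/percolation
bridges to CriticalPhenomena only); arXiv abstracts checked: 2203.04163, 2203.05093, 2305.10690,
2007.08200, 2202.02301, 0911.1721; `lit search` local index (searchd) unavailable 13:40–14:40Z;
remote: `--source arxiv "stochastic localization lattice gauge theory"` (8 rows: Lüscher stochastic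
locality arXiv:1707.09758, event-chain MC arXiv:2606.21217 — simulation, no theorems), `--source
arxiv "Poincare inequality lattice Yang-Mills mass gap"` (0), `--source zbmath "log-Sobolev lattice
gauge theory"` (0), `--source zbmath "Dobrushin uniqueness lattice gauge theory"` (3, none on gauge
theory), openalex/s2 rate-limited (429); plus the card's and the refuter audit's recorded searches
(zbMATH ×6, crossref, ope  [refs: 10.4171/owr/2023/59, 1712.01791, 2203.04163, 2606.19362, 1707.09758, 2606.21217, 2204.12737, 2007.08200, doi:10.4171/owr/2023/59, ShenZhuZhu2022, BauerschmidtBodineauDagallierPolchinski2024, BauerschmidtDagallier2023, DingSongSun2022, Wu2006, FradkinShenker1979, OsterwalderSeilerAnnPhys1978]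

Barriers (technique_class: stochastic-localisation, glauber-poincare, sharpness): - technique_class: stochastic-localisation, glauber-poincare, sharpness
- Literature.Barriers.QuantumFields.AbelianDeconfinementD4: the machinery is group-blind by design
and CONDITIONAL on finite gauge-invariant susceptibility; for U(1)₄ (and any G with a U(1) factor
through a reducible faithful r of a non-simple group — excluded here by IsCompactSimpleLieGroup) the
Coulomb phase has χ_inv = ∞ (Guth1980, Fröhlich–Spencer 1982), so crux 3 fails and crux 2 asserts
nothing false; the route never "proves clustering for every compact G".
- Literature.Barriers.QuantumFields.ElitzurTheorem: used as a resource twice — at s = 0 it bounds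
the link covariance operator by N (ElitzurLinkCovariance), and in the frame/orbit decomposition it
makes the gauge frame a high-temperature spin system at weak pinning; the pinned measures are
explicitly non-invariant (external link field), where Elitzur's theorem says nothing.
- Literature.Barriers.QuantumFields.FixedCouplingUltralocality: the route works at fixed β and fixed
lattice only to certify positivity of the gap; the continuum limit is taken in the complement (crux
4) along β_k → ∞ at the scale of the true mass, never at fixed coupling.
- Literature.Barriers.QuantumFields.FiniteTemperatureDeconfinement: all statements are on symmetric
tori (ℤ/(2S+1))⁴, uniform in S; Borgs–Seiler deconfinement concerns Polyakov-loop order at fixed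
temporal extent L₀ ≪ spatial size and does not contradict clustering of local observables or a
heat-bath Poincar

History (route lifecycle, newest last):
- 2026-08-24T23:38:45Z · DORMANT — reconciler: no traction for 7.2 d (last activity item-evidence-added at 2026-08-17T18:54:50Z); parked, not closed — `ledger route dormant route-QuantumFields-Fr (operator:999:805681)

sub-problem: YangMills · status: dormant · opened planner-plancard-QuantumFields-YangMills-ricc-0dcfd25f-0 2026-08-15T13:57:22Z · rev 6 · ledger route-QuantumFields-FradkinShenkerFlow
GENERATED by the gate from the ledger (D-0016/17). Provers cite these decls: `theorem foo : Summit.QuantumFields.YangMills.Theses.FradkinShenkerFlow.<Decl> := …` in Summits/QuantumFields/YangMills/Theorems/<Name>.lean.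
-/

namespace Summit.QuantumFields.YangMills.Theses.FradkinShenkerFlow

open scoped BigOperators Topology Manifold Classical MeasureTheory ProbabilityTheory Matrix InnerProductSpace ComplexConjugate ContinuousMap
open Filter Set Function TopologicalSpace MeasureTheory

attribute [summit_statement] _root_.YangMills

/-- item stmt-QuantumFields-9440 · target · rank 0 · open · by planner
why it might fail: Conjunct 1 = crux 2: FS bounds only singlet (energy-like) susceptibilities, finite at an alpha<0 continuous transition (xi infinite) or alongside a slow global heat-bath mode, so FS=>UP can fail; conjunct 2 (UP=>EC) is the standard gap + finite-speed argument for the rate-1 heat bath.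
sources: BauerschmidtDagallier2023, arXiv:2203.04163, Cardy1996, BhanotCreutz1981, Martinelli1999, MartinelliOlivieri1994
[target] X of the Thesis: (FS ⇒ UP) for every compact simple G, faithful unitary r, β ≥ 0, and (UP ⇒
EC) for every compact G with a lattice representation r and β ≥ 0 — finite gauge-invariant
susceptibility upgrades to a uniform heat-bath Poincaré inequality, which gives volume-uniform
exponential clustering in Euclidean time. -/
@[route_item "route-QuantumFields-FradkinShenkerFlow"]
def GaugeSharpness : Prop :=
  (∀ (G : Type) [Group G] [TopologicalSpace G] [IsTopologicalGroup G] [CompactSpace G] [MeasurableSpace G] [BorelSpace G], Literature.MathematicalPhysics.QuantumFieldTheory.IsCompactSimpleLieGroup G → ∀ (r : Literature.MathematicalPhysics.QuantumFieldTheory.LatticeRep G) (β : ℝ), 0 ≤ β → (∀ A B : Literature.MathematicalPhysics.QuantumFieldTheory.YMSpecies G, ∃ χ : ℝ, ∀ S : ℕ, ∑ x ∈ Literature.Probability.LatticeModels.box 4 S, |ProbabilityTheory.covariance (fun U => A.F (Literature.MathematicalPhysics.QuantumLattice.torusLift (2 * S + 1) U)) (fun U => B.F (Literature.MathematicalPhysics.QuantumLattice.configShift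 (-x) (Literature.MathematicalPhysics.QuantumLattice.torusLift (2 * S + 1) U))) (Literature.MathematicalPhysics.QuantumFieldTheory.wilsonMeasure (d := 4) (L := 2 * S + 1) r.ρ β)| ≤ χ) → (∃ C : ℝ, ∀ S : ℕ, ∀ F : Literature.MathematicalPhysics.QuantumFieldTheory.GaugeConfig 4 (2 * S + 1) G → ℝ, Measurable F → (∃ M : ℝ, ∀ U, |F U| ≤ M) → ProbabilityTheory.variance F (Literature.MathematicalPhysics.QuantumFieldTheory.wilsonMeasure (d := 4) (L := 2 * S + 1) r.ρ β) ≤ C * ∑ ℓ : Literature.MathematicalPhysics.QuantumFieldTheory.Edge 4 (2 * S + 1), ∫ U, ∫ g, (F U - F (Function.update U ℓ g)) ^ 2 ∂((Literature.MathematicalPhysics.QuantumFieldTheory.haarProbability G).tilted (fun g' => -β * Literature.MathematicalPhysics.QuantumFieldTheory.wilsonAction r.ρ (Function.update U ℓ g'))) ∂(Literature.MathematicalPhysics.QuantumFieldTheory.wilsonMeasure (d := 4) (L := 2 * S + 1) r.ρ β))) ∧ (∀ (G : Type) [Group G] [TopologicalSpace G] [IsTopologicalGroup G] [CompactSpace G]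 [MeasurableSpace G] [BorelSpace G], ∀ (r : Literature.MathematicalPhysics.QuantumFieldTheory.LatticeRep G) (β : ℝ), 0 ≤ β → (∃ C : ℝ, ∀ S : ℕ, ∀ F : Literature.MathematicalPhysics.QuantumFieldTheory.GaugeConfig 4 (2 * S + 1) G → ℝ, Measurable F → (∃ M : ℝ, ∀ U, |F U| ≤ M) → ProbabilityTheory.variance F (Literature.MathematicalPhysics.QuantumFieldTheory.wilsonMeasure (d := 4) (L := 2 * S + 1) r.ρ β) ≤ C * ∑ ℓ : Literature.MathematicalPhysics.QuantumFieldTheory.Edge 4 (2 * S + 1), ∫ U, ∫ g, (F U - F (Function.update U ℓ g)) ^ 2 ∂((Literature.MathematicalPhysics.QuantumFieldTheory.haarProbability G).tilted (fun g' => -β * Literature.MathematicalPhysics.QuantumFieldTheory.wilsonAction r.ρ (Function.update U ℓ g'))) ∂(Literature.MathematicalPhysics.QuantumFieldTheory.wilsonMeasure (d := 4) (L := 2 * S + 1) r.ρ β)) → (∃ m : ℝ, 0 < m ∧ ∀ A B : Literature.MathematicalPhysics.QuantumFieldTheory.YMSpecies G, ∃ C : ℝ, ∀ S n : ℕ, n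 ≤ S → |Literature.MathematicalPhysics.QuantumFieldTheory.latticeConnectedCorr r.ρ β (2 * S + 1) A.F B.F n| ≤ C * Real.exp (-(m * n))))

/-- item stmt-QuantumFields-9441 · crux · rank 2 · open · by planner
why it might fail: FS bounds only singlet susceptibilities: at an alpha<0 continuous bulk transition they stay finite while xi is infinite, so UP(=>EC) fails with FS true; not excluded for simple G, any faithful r (mixed actions: first-order lines with critical endpoints); weak mixing => gap is proved only in d=2.
sources: Cardy1996, BhanotCreutz1981, doi:10.1007/bf02099735, MartinelliOlivieri1994, Martinelli1999, arXiv:0911.1721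
[crux] (card N3+N1 in measure form) for compact simple G, faithful unitary r, β ≥ 0: if for all
bounded gauge-invariant local observables A, B the susceptibility Σ_(x ∈ box 4 S) |Cov_(β,S)(A∘lift,
B∘τ_x∘lift)| is bounded uniformly in S, then there is C with Var_(μ_β,S)(F) ≤ C Σ_ℓ ∫∫ (F(U) − F(U[ℓ
↦ g]))² dν_ℓ^U(g) dμ_(β,S)(U) for all S and all bounded measurable F, ν_ℓ^U = the one-link
conditional (heat-bath) law ∝ e^(−β S_W(U[ℓ↦g])) dHaar(g). Intended proof: stochastic localisation
in link coordinates from s = 0 (ElitzurLinkCovariance) through the planted Fradkin–Shenker window to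
the Dobrushin regime (StrongPinningPoincare); any other proof (multiscale Bakry–Émery along the heat
kernel, BBD Thm 4 with Ric_G; weak-mixing ⇒ gap à la Martinelli–Olivieri on tori) closes it equally.
[deps: ElitzurLinkCovariance, StrongPinningPoincare] [difficulty: XL] -/
@[route_item "route-QuantumFields-FradkinShenkerFlow", crux]
def SusceptibilityToPoincare : Prop :=
  ∀ (G : Type) [Group G] [TopologicalSpace G] [IsTopologicalGroup G] [CompactSpace G] [MeasurableSpace G] [BorelSpace G], Literature.MathematicalPhysics.QuantumFieldTheory.IsCompactSimpleLieGroup G → ∀ (r : Literature.MathematicalPhysics.QuantumFieldTheory.LatticeRep G) (β : ℝ), 0 ≤ β → (∀ A B : Literature.MathematicalPhysics.QuantumFieldTheory.YMSpecies G, ∃ χ : ℝ, ∀ S : ℕ, ∑ x ∈ Literature.Probability.LatticeModels.box 4 S, |ProbabilityTheory.covariance (fun U => A.F (Literature.MathematicalPhysics.QuantumLattice.torusLift (2 * S + 1) U)) (fun U => B.F (Literature.MathematicalPhysics.QuantumLattice.configShift (-x) (Literature.MathematicalPhysics.QuantumLattice.torusLift (2 * S + 1) U))) (Literature.MathematicalPhysics.QuantumFieldTheory.wilsonMeasure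 (d := 4) (L := 2 * S + 1) r.ρ β)| ≤ χ) → (∃ C : ℝ, ∀ S : ℕ, ∀ F : Literature.MathematicalPhysics.QuantumFieldTheory.GaugeConfig 4 (2 * S + 1) G → ℝ, Measurable F → (∃ M : ℝ, ∀ U, |F U| ≤ M) → ProbabilityTheory.variance F (Literature.MathematicalPhysics.QuantumFieldTheory.wilsonMeasure (d := 4) (L := 2 * S + 1) r.ρ β) ≤ C * ∑ ℓ : Literature.MathematicalPhysics.QuantumFieldTheory.Edge 4 (2 * S + 1), ∫ U, ∫ g, (F U - F (Function.update U ℓ g)) ^ 2 ∂((Literature.MathematicalPhysics.QuantumFieldTheory.haarProbability G).tilted (fun g' => -β * Literature.MathematicalPhysics.QuantumFieldTheory.wilsonAction r.ρ (Function.update U ℓ g'))) ∂(Literature.MathematicalPhysics.QuantumFieldTheory.wilsonMeasure (d := 4) (L := 2 * S + 1) r.ρ β))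

/-- item stmt-QuantumFields-9442 · crux · rank 3 · open · by planner
why it might fail: Infrared half of the lattice mass gap (Chatterjee Problem 5.1), open for all non-abelian G in d=4; all faithful r quantified, so only beta>=beta0(G,r) (mixed fund-adjoint actions cross bulk first-order lines); a weak-coupling massless or alpha<0 critical phase for some simple G falsifies it.
sources: arXiv:1803.01950, JaffeWitten2000, Guth1980, FrohlichSpencerCMP1982, BhanotCreutz1981, Balaban1989LargeFieldII
[crux] IMPORTED INPUT: for compact simple G and faithful unitary r there is β₀(G,r) such that for
every β ≥ β₀ and all bounded gauge-invariant local A, B, sup_S Σ_(x ∈ box 4 S) |Cov_(β,S)(A∘lift,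
B∘τ_x∘lift)| < ∞ — the absolutely-summable shadow of Chatterjee's Problem 5.1 / Jaffe–Witten §5 at
weak coupling (β₀ beyond bulk transitions and endpoints of reducible r). This route does not attack
it; written so that routes proving clustering or susceptibility bounds from RG / flux / continuity
arguments attach here. [difficulty: open-problem] -/
@[route_item "route-QuantumFields-FradkinShenkerFlow", crux]
def FiniteSusceptibilityWeakCoupling : Prop :=
  ∀ (G : Type) [Group G] [TopologicalSpace G] [IsTopologicalGroup G] [CompactSpace G] [MeasurableSpace G] [BorelSpace G], Literature.MathematicalPhysics.QuantumFieldTheory.IsCompactSimpleLieGroup G → ∀ (r : Literature.MathematicalPhysics.QuantumFieldTheory.LatticeRep G), ∃ β₀ : ℝ, ∀ β : ℝ, β₀ ≤ β → (∀ A B : Literature.MathematicalPhysics.QuantumFieldTheory.YMSpecies G, ∃ χ : ℝ, ∀ S : ℕ, ∑ x ∈ Literature.Probability.LatticeModels.box 4 S, |ProbabilityTheory.covariance (fun U => A.F (Literature.MathematicalPhysics.QuantumLattice.torusLift (2 * S + 1) U)) (fun U => B.F (Literature.MathematicalPhysics.QuantumLattice.configShift (-x) (Literature.MathematicalPhysics.QuantumLattice.torusLift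 (2 * S + 1) U))) (Literature.MathematicalPhysics.QuantumFieldTheory.wilsonMeasure (d := 4) (L := 2 * S + 1) r.ρ β)| ≤ χ)

/-- item stmt-QuantumFields-9443 · crux · rank 4 · open · by planner
why it might fail: EC at fixed beta is lattice-only; YangMills needs xi(beta)->oo, a continuum limit of ALL species with E1 rotations (Balaban: stability, not uniqueness/invariance), non-Gaussian tr F^2 (phi^4_4 triviality!), k-uniform C in HasLatticeMassGap (EC gives C(A,B,beta); n<=S on tori is thermal): all open.
sources: JaffeWitten2000, arXiv:1803.01950, Balaban1989LargeFieldII, MagnenRivasseauSeneor1993, arXiv:1912.07973, OsterwalderSeilerAnnPhys1978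
[crux] IMPORTED COMPLEMENT (lowest rank): if for every compact simple G and faithful unitary r the
torus Wilson measures cluster exponentially in Euclidean time, uniformly in the volume, at every β ≥
β₀(G,r) (rate m(β) > 0, constants C(A,B,β)), then YangMills: by RP/transfer-matrix spectral theory
EC makes the infinite-volume gap m_true(β) positive and self-normalises the constants (torus clause,
cf. card torus-clause-is-thermal-v2); choose β_k → ∞ and a_k m_true(β_k) → Δ_phys (needs ξ(β) → ∞);
build the OS continuum limit for all species (E0, E0', E1–E4), non-triviality and non-Gaussianity of
tr F², HasMassGap and HasLatticeMassGap. The conjunct minus the lattice-gap-positivity leg, so that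
UV/continuum routes attach here. [difficulty: open-problem] -/
@[route_item "route-QuantumFields-FradkinShenkerFlow", crux]
def ClusteringToYangMills : Prop :=
  (∀ (G : Type) [Group G] [TopologicalSpace G] [IsTopologicalGroup G] [CompactSpace G] [MeasurableSpace G] [BorelSpace G], Literature.MathematicalPhysics.QuantumFieldTheory.IsCompactSimpleLieGroup G → ∀ (r : Literature.MathematicalPhysics.QuantumFieldTheory.LatticeRep G), ∃ β₀ : ℝ, ∀ β : ℝ, β₀ ≤ β → (∃ m : ℝ, 0 < m ∧ ∀ A B : Literature.MathematicalPhysics.QuantumFieldTheory.YMSpecies G, ∃ C : ℝ, ∀ S n : ℕ, n ≤ S → |Literature.MathematicalPhysics.QuantumFieldTheory.latticeConnectedCorr r.ρ β (2 * S + 1) A.F B.F n| ≤ C * Real.exp (-(m * n)))) → YangMills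

/-- item stmt-QuantumFields-18060 · support · rank 3 · open · by planner
[crux] PURITY HALF of FiniteSusceptibilityWeakCoupling (crux-strategist gen-2 split of
stmt-QuantumFields-9442; certified necessary and, together with DecorrelationForcesSummability,
sufficient: tree SpeciesParity.finiteSusceptibilityWeakCoupling_iff_even_subs, p144906): for compact
simple G and faithful unitary r there is β₀ such that at every β ≥ β₀ NO reflection-EVEN
gauge-invariant local observable A (A∘Θ = A, Θ = cfgReflect the site time reflection) has long-range
order along the time axis: its connected autocorrelation latticeConnectedCorr r.ρ β (2S+1) A A j
tends to 0 as j → ∞ UNIFORMLY in the odd tori (2S+1)⁴ with S ≥ j. Zero-rate and group-blind (it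
holds in the U(1)₄ Coulomb phase); each term is ≥ 0 and non-increasing in j beyond the support scale
(RP: MirrorLogConvex.mirrorCorr_nonneg, MirrorMonotone), so it is smallness at ONE large lag
uniformly in large volumes (MirrorFixedLag) = no long-range order = extremality of the weak-coupling
torus limit in the gauge-invariant sector; the reflection-ODD sector is PROVED for every compact G
at every β ≥ 0 with a β-uniform 1/j rate (OddSector, ShiftedOddSector, OddSectorRate: lattice
Vafa–Witten). Remaining enemies: phase coexis -/
@[route_item "route-QuantumFields-FradkinShenkerFlow"]
def NoEvenLongRangeOrder : Prop :=
  ∀ (G : Type) [Group G] [TopologicalSpace G] [IsTopologicalGroup G] [CompactSpace G] [MeasurableSpace G] [BorelSpace G], Literature.MathematicalPhysics.QuantumFieldTheory.IsCompactSimpleLieGroup G → ∀ r : Literature.MathematicalPhysics.QuantumFieldTheory.LatticeRep G, ∃ β₀ : ℝ, ∀ β : ℝ, β₀ ≤ β → ∀ A : Literature.MathematicalPhysics.QuantumFieldTheory.YMSpecies G, (∀ V, A.F (Literature.MathematicalPhysics.QuantumFieldTheory.cfgReflect V) = A.F V) → ∀ ε : ℝ, 0 < ε → ∃ j₀ : ℕ,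 ∀ S j : ℕ, j₀ ≤ j → j ≤ S → |Literature.MathematicalPhysics.QuantumFieldTheory.latticeConnectedCorr r.ρ β (2 * S + 1) A.F A.F j| ≤ ε

/-- item stmt-QuantumFields-18061 · support · rank 4 · open · by planner
[crux] RATE HALF of FiniteSusceptibilityWeakCoupling (crux-strategist gen-2 split of
stmt-QuantumFields-9442; the crux implies it trivially, tree
decorrelationForcesSummability_of_finiteSusceptibility; with NoEvenLongRangeOrder it gives the crux,
finiteSusceptibilityWeakCoupling_iff_even_subs): for compact simple G and faithful unitary r there
is β₀ such that at every β ≥ β₀, IF every pair of gauge-invariant local observables decorrelates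
along the time axis uniformly in the odd tori (purity; at fixed β equivalent to the even-sector
clause, SpeciesParity.mirrorDecorrelation_iff_even + Split.decorrelation_of_mirrorDecorrelation),
THEN the susceptibility clause holds: Σ_{x ∈ box 4 S} |Cov_{β,S}(A∘lift, B∘τ_x∘lift)| ≤ χ(A,B,β) for
all S. 'Mixing ⇒ finite susceptibility at weak coupling': the window 0 < Δ ≤ 2 of gauge-invariant
infrared fields (emergent photon = Δ 2 two-form, light scalar) is empty for simple G. Carries the
WHOLE load of IsCompactSimpleLieGroup — false for U(1)₄, whose Coulomb phase decorrelates with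
Σ|Cov| ~ log S through the C-odd field strength (Fröhlich–Spencer 1982 §2.11; Disproof
withoutSimple_false_of_u1TorusPlaquetteNonSummable). G-entry lemmas landed: SimpleRe -/
@[route_item "route-QuantumFields-FradkinShenkerFlow"]
def DecorrelationForcesSummability : Prop :=
  ∀ (G : Type) [Group G] [TopologicalSpace G] [IsTopologicalGroup G] [CompactSpace G] [MeasurableSpace G] [BorelSpace G], Literature.MathematicalPhysics.QuantumFieldTheory.IsCompactSimpleLieGroup G → ∀ r : Literature.MathematicalPhysics.QuantumFieldTheory.LatticeRep G, ∃ β₀ : ℝ, ∀ β : ℝ, β₀ ≤ β → (∀ A B : Literature.MathematicalPhysics.QuantumFieldTheory.YMSpecies G, ∀ ε : ℝ, 0 < ε → ∃ n₀ : ℕ, ∀ S n : ℕ, n₀ ≤ n → n ≤ S → |Literature.MathematicalPhysics.QuantumFieldTheory.latticeConnectedCorr r.ρ β (2 * S + 1) A.F B.F n| ≤ ε) → ∀ A B : Literature.MathematicalPhysics.QuantumFieldTheory.YMSpecies G, ∃ χ : ℝ, ∀ S : ℕ, ∑ x ∈ Literature.Probability.LatticeModels.box 4 S, |ProbabilityTheory.covariance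 (fun U => A.F (Literature.MathematicalPhysics.QuantumLattice.torusLift (2 * S + 1) U)) (fun U => B.F (Literature.MathematicalPhysics.QuantumLattice.configShift (-x) (Literature.MathematicalPhysics.QuantumLattice.torusLift (2 * S + 1) U))) (Literature.MathematicalPhysics.QuantumFieldTheory.wilsonMeasure (d := 4) (L := 2 * S + 1) r.ρ β)| ≤ χ

/-- item stmt-QuantumFields-9444 · support · rank 9 · closed · proved by Summit.QuantumFields.YangMills.Theorems.poincareToClustering_proof (prover) · by planner
sources: Martinelli1999, Liggett2005, ShenZhuZhu2022, Wu2006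
[support] (card N4, heat-bath form) for compact G with lattice representation r and β ≥ 0: the
uniform heat-bath Poincaré inequality UP(β) implies ∃ m(β) > 0 ∀ A, B ∃ C ∀ S, n ≤ S: |⟨A·τ_(n
e₀)B⟩_(β,S) − ⟨A⟩⟨B⟩| ≤ C e^(−m n). Proof route: spectral gap λ ≥ 1/(2C_UP) of the continuous-time
single-link heat-bath generator L = Σ_ℓ (E_ℓ − 1), Cov(F,G) = 2∫₀^∞ E Γ(P_sF, P_sG) ds,
β-independent finite speed of propagation of the heat bath (influence graph = links sharing a
plaquette), split at s* ∝ dist; observables whose support exceeds small tori are absorbed in C.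
[difficulty: L] -/
@[route_item "route-QuantumFields-FradkinShenkerFlow", crux]
def PoincareToClustering : Prop :=
  ∀ (G : Type) [Group G] [TopologicalSpace G] [IsTopologicalGroup G] [CompactSpace G] [MeasurableSpace G] [BorelSpace G], ∀ (r : Literature.MathematicalPhysics.QuantumFieldTheory.LatticeRep G) (β : ℝ), 0 ≤ β → (∃ C : ℝ, ∀ S : ℕ, ∀ F : Literature.MathematicalPhysics.QuantumFieldTheory.GaugeConfig 4 (2 * S + 1) G → ℝ, Measurable F → (∃ M : ℝ, ∀ U, |F U| ≤ M) → ProbabilityTheory.variance F (Literature.MathematicalPhysics.QuantumFieldTheory.wilsonMeasure (d := 4) (L := 2 * S + 1) r.ρ β) ≤ C * ∑ ℓ : Literature.MathematicalPhysics.QuantumFieldTheory.Edge 4 (2 * S + 1), ∫ U, ∫ g, (F U - F (Function.update U ℓ g)) ^ 2 ∂((Literature.MathematicalPhysics.QuantumFieldTheory.haarProbability G).tilted (fun g' => -β * Literature.MathematicalPhysics.QuantumFieldTheory.wilsonAction r.ρ (Function.update U ℓ g'))) ∂(Literature.MathematicalPhysics.QuantumFieldTheory.wilsonMeasure (d :=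 4) (L := 2 * S + 1) r.ρ β)) → (∃ m : ℝ, 0 < m ∧ ∀ A B : Literature.MathematicalPhysics.QuantumFieldTheory.YMSpecies G, ∃ C : ℝ, ∀ S n : ℕ, n ≤ S → |Literature.MathematicalPhysics.QuantumFieldTheory.latticeConnectedCorr r.ρ β (2 * S + 1) A.F B.F n| ≤ C * Real.exp (-(m * n)))

/-- item stmt-QuantumFields-9445 · support · rank 9 · closed · proved by Summit.QuantumFields.YangMills.Theorems.ElitzurLinkCovariance_proof (prover) · by planner
sources: Elitzur1975, Wilson1974, Seiler1982
[support] the s = 0 end of the window, provable now: for every compact G, lattice representation r,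
β, and torus side 2S+1 ≥ 3, gauge invariance of μ_(β,S) (proved:
wilsonMeasure_map_gaugeTransform_holds) makes the matrix coordinates of distinct links uncorrelated
(average the gauge rotation at an endpoint of ℓ that is not an endpoint of ℓ' : ∫ρ(g) dg is the
projection onto ρ-invariants, which commutes with ρ), so Var(Σ_ℓ Re tr(h_ℓ ρ(U_ℓ))) = Σ_ℓ Var(Re
tr(h_ℓ ρ(U_ℓ))) ≤ N Σ_ℓ ‖h_ℓ‖_F² (Cauchy–Schwarz, ‖ρ(U)‖_F² = N): the covariance operator of the
link coordinates is bounded by N uniformly in S and β. [difficulty: provable-now] -/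
@[route_item "route-QuantumFields-FradkinShenkerFlow"]
def ElitzurLinkCovariance : Prop :=
  ∀ (G : Type) [Group G] [TopologicalSpace G] [IsTopologicalGroup G] [CompactSpace G] [MeasurableSpace G] [BorelSpace G], ∀ (r : Literature.MathematicalPhysics.QuantumFieldTheory.LatticeRep G) (β : ℝ) (S : ℕ), 1 ≤ S → ∀ h : Literature.MathematicalPhysics.QuantumFieldTheory.Edge 4 (2 * S + 1) → Matrix (Fin r.N) (Fin r.N) ℂ, ProbabilityTheory.variance (fun U => ∑ ℓ, ((h ℓ) * r.ρ (U ℓ)).trace.re) (Literature.MathematicalPhysics.QuantumFieldTheory.wilsonMeasure (d := 4) (L := 2 * S + 1) r.ρ β) ≤ (r.N : ℝ) * ∑ ℓ, ∑ i, ∑ j, ‖h ℓ i j‖ ^ 2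

/-- item stmt-QuantumFields-9446 · support · rank 9 · closed · proved by Summit.QuantumFields.YangMills.Theorems.StrongPinningPoincare_proof (prover) · by planner
sources: Wu2006, Dobrushin1968, ShenZhuZhu2022, arXiv:2204.12737
[support] the late end of the window (Dobrushin regime): there are c, C (depending on G, r) such
that for every β ≥ 0, every pinning strength s ≥ c(1+β), every torus and EVERY background X, the
pinned Wilson measure μ^(s,X) ∝ exp(s Σ_ℓ Re tr ρ(X_ℓ⁻¹ W_ℓ)) μ_(β,S) satisfies the heat-bath
Poincaré inequality with constant C w.r.t. its own one-link conditional laws ∝ e^(−βS_W(U[ℓ↦g]) + s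
Re tr ρ(X_ℓ⁻¹g)) dHaar(g): one-link laws concentrate at scale s^(−1/2) around the unique
non-degenerate maximum (r faithful), staples move them by O(β/s) in W₁ (perturbation lemma of
LatticeGaugeDobrushinPoincare), so Dobrushin's coefficient is ≤ Cβ/s < 1, and Wu2006 turns Dobrushin
uniqueness into the Poincaré inequality for the heat bath. [difficulty: M] -/
@[route_item "route-QuantumFields-FradkinShenkerFlow"]
def StrongPinningPoincare : Prop :=
  ∀ (G : Type) [Group G] [TopologicalSpace G] [IsTopologicalGroup G] [CompactSpace G] [MeasurableSpace G] [BorelSpace G], Literature.MathematicalPhysics.QuantumFieldTheory.IsCompactSimpleLieGroup G → ∀ (r : Literature.MathematicalPhysics.QuantumFieldTheory.LatticeRep G), ∃ c C : ℝ, ∀ (β : ℝ), 0 ≤ β → ∀ s : ℝ, c * (1 + β) ≤ s → ∀ S : ℕ, ∀ X : Literature.MathematicalPhysics.QuantumFieldTheory.GaugeConfig 4 (2 * S + 1) G, ∀ F : Literature.MathematicalPhysics.QuantumFieldTheory.GaugeConfig 4 (2 * S + 1) G → ℝ, Measurable F → (∃ M : ℝ, ∀ U, |F U| ≤ M) → ProbabilityTheory.variance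 F ((Literature.MathematicalPhysics.QuantumFieldTheory.wilsonMeasure (d := 4) (L := 2 * S + 1) r.ρ β).tilted (fun W => s * ∑ ℓ, (r.ρ ((X ℓ)⁻¹ * W ℓ)).trace.re)) ≤ C * ∑ ℓ : Literature.MathematicalPhysics.QuantumFieldTheory.Edge 4 (2 * S + 1), ∫ U, ∫ g, (F U - F (Function.update U ℓ g)) ^ 2 ∂((Literature.MathematicalPhysics.QuantumFieldTheory.haarProbability G).tilted (fun g' => -β * Literature.MathematicalPhysics.QuantumFieldTheory.wilsonAction r.ρ (Function.update U ℓ g') + s * (r.ρ ((X ℓ)⁻¹ * g')).trace.re)) ∂((Literature.MathematicalPhysics.QuantumFieldTheory.wilsonMeasure (d := 4) (L := 2 * S + 1) r.ρ β).tilted (fun W => s * ∑ ℓ, (r.ρ ((X ℓ)⁻¹ * W ℓ)).trace.re))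

/-- item stmt-QuantumFields-9447 · assembly · rank 1 · closed · proved by Summit.QuantumFields.YangMills.Theorems.fradkinShenkerFlow_assembly_proof @ 3ffeb756c9fb (prover) · by planner
sources: JaffeWitten2000, BauerschmidtBodineauDagallierPolchinski2024
[assembly] SusceptibilityToPoincare → PoincareToClustering → FiniteSusceptibilityWeakCoupling →
ClusteringToYangMills → YangMills. -/
@[route_item "route-QuantumFields-FradkinShenkerFlow"]
def Assembly : Prop :=
  SusceptibilityToPoincare → PoincareToClustering → FiniteSusceptibilityWeakCoupling → ClusteringToYangMills → YangMills

/-! D-0027 §2.1 — DECIDING THEOREM (planner-authored via `route open/edit --closes-file`; by planner-rrepair-QuantumFields-FradkinShenkerFl-2919f865-0 2026-08-16T17:42:13Z):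
its hypotheses are this route's items and its conclusion the sub-problem Statement (glue_lint), and it elaborates with this file. -/

@[closes "route-QuantumFields-FradkinShenkerFlow"] theorem closes (hSP : SusceptibilityToPoincare) (hPC : PoincareToClustering)
    (hFS : FiniteSusceptibilityWeakCoupling) (hCY : ClusteringToYangMills) : YangMills := by
  refine hCY ?_
  intro G _ _ _ _ _ _ hG r
  obtain ⟨β₀, hβ₀⟩ := hFS G hG r
  refine ⟨max β₀ 0, fun β hβ => ?_⟩
  have h0 : (0 : ℝ) ≤ β := le_trans (le_max_right _ _) hβ
  exact hPC G r β h0 (hSP G hG r β h0 (hβ₀ β (le_trans (le_max_left _ _) hβ)))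

end Summit.QuantumFields.YangMills.Theses.FradkinShenkerFlow
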